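import Mathlib.LinearAlgebra.Dimension.Finrank
import Mathlib.LinearAlgebra.FiniteDimensional.Defs
import Mathlib.Data.Set.Card
import HarnessLib

/-!
# Odlyzko's lemma: a `d`-dimensional affine subspace contains at most `2^d` hypercube vertices

Named fact (D-0014) from A. M. Odlyzko, *On subspaces spanned by random selections of `±1`
vectors*, J. Combin. Theory Ser. A 47 (1988) 124–133 [Odlyzko1988], the counting step in the proof
of Proposition 2.2 (p. 127 of the journal, read on the held copy
paper:doi-10-1016-0097-3165-88-90046-5 p.4): "If columns `j₁ < ⋯ < j_m ≤ m + q` of `M` are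
linearly independent, then for each choice of `a₁, …, a_m ∈ {±1}`, there will be a unique set of
coefficients `x₁, …, x_m` with the `j_i`th coordinate of `x₁w₁ + ⋯ + x_m w_m` equal to `a_i`.  Thus
there will be at most `2^m` sets of `x₁, …, x_m` … with the property that the first `m + q`
coordinates of `x₁w₁ + ⋯ + x_m w_m` are all `±1`."  In the form in which it is universally quoted
("Odlyzko's lemma", e.g. Kahn–Komlós–Szemerédi 1995 §1; Tao–Vu, *Additive Combinatorics* §7): a
linear subspace of dimension `d` of `ℝⁿ` contains at most `2^d` sign vectors; equivalently (same
pivot argument, any field, any translate) an affine subspace whose direction has dimension `d`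
contains at most `2^d` points of the hypercube `{0,1}ⁿ` — a point of the affine subspace is
determined by its values on `d` pivot coordinates, each of which has two admissible values.

Vendored because route `ValiantsHypothesis/FreeSubtorus` (crux `SubtorusCovering`,
stmt-ValiantsHypothesis-16134) uses it as the covering count "one grade class of `ℤ^{2n}/Λ` holds at
most `2^{rank Λ}` of the pairs `(1_S, 1_{σ(S)})`": the fibres of `ℤ^{2n} → ℤ^{2n}/Λ_sat` are the
translates of the rank-`r` lattice `Λ_sat`, whose real (or rational) span is an `r`-dimensional
subspace.  Elementary and provable in the tree (a literature-prover may discharge it: choose `d`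
coordinate functionals restricting to a basis of the dual of the direction); filed as a fact so the
crux's prover has a name to cite now.
-/

namespace Literature.Computability.AlgebraicComplexity

universe u

/-- NAMED FACT — **Odlyzko's lemma (hypercube form).** For a field `K`, a linear subspace
`V ≤ Kᴺ` and any base point `x₀`, the translate `x₀ + V` contains at most `2 ^ dim V` vectors all
of whose coordinates lie in `{0, 1}`:
`#{x ∈ {0,1}ᴺ : x - x₀ ∈ V} ≤ 2^{finrank_K V}` (`Set.ncard`; the set is finite, being a subset of
the finite hypercube).  Printed for sign vectors `{±1}ⁿ ⊂ ℝⁿ` and linear subspaces inside the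
proof of Prop. 2.2 ("there will be at most `2^m` sets of `x₁, …, x_m` … with the property that the
… coordinates … are all `±1`"); the `{0,1}`/affine/any-field version is the same pivot-coordinate
argument. [cite: Odlyzko1988, proof of Prop. 2.2, p. 127] -/
def odlyzko_ncard_hypercube_inter_translate_le : Prop :=
  ∀ (K : Type u) [Field K] (N : ℕ) (V : Submodule K (Fin N → K)) (x₀ : Fin N → K),
    {x : Fin N → K | (∀ i, x i = 0 ∨ x i = 1) ∧ x - x₀ ∈ V}.ncard ≤ 2 ^ Module.finrank K V

/-- The linear (`x₀ = 0`) sign-free special case, as a sanity instance of the fact: a subspace of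
dimension `d` contains at most `2^d` hypercube vertices. [cite: Odlyzko1988, proof of Prop. 2.2, p. 127] -/
theorem odlyzko_ncard_hypercube_inter_le (h : odlyzko_ncard_hypercube_inter_translate_le.{u})
    (K : Type u) [Field K] (N : ℕ) (V : Submodule K (Fin N → K)) :
    {x : Fin N → K | (∀ i, x i = 0 ∨ x i = 1) ∧ x ∈ V}.ncard ≤ 2 ^ Module.finrank K V := by
  simpa using h K N V 0

end Literature.Computability.AlgebraicComplexity
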